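import Literature.AlgebraicGeometry.Modules.PullbackSectionsTransport
import HarnessLib

/-!
# The base-change morphism is Zariski-local on the base: restricting the square over an open `V ⊆ S`

[Hartshorne1977] III Prop. 9.3 (proof) / [StacksProject, Tag 02KH]: whether the base change map
`β : b^*(p_* G) ⟶ p_{T*}(pr^* G)` of a commutative square `pr ≫ p = pT ≫ b` is an isomorphism is a LOCAL question on the base
`S`.  This file makes the reduction «general base `S` ⇒ affine base» usable by name, in the chart currency of ★
`Modules/PushforwardBaseChangeCharts` (FILE D) / ★ `Modules/PushforwardBaseChangeChartsTop` (S1/S2):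

* §1 the square RESTRICTED OVER an open `V ⊆ S`, in Mathlib `Scheme.Hom.resLE` letters —
  `p_V := p.resLE V (p⁻¹V) le_rfl : p⁻¹V ⟶ V`, `b_V := b.resLE V (b⁻¹V) le_rfl`, `pT_V := pT.resLE (b⁻¹V) (pT⁻¹b⁻¹V) le_rfl`,
  `pr_V := pr.resLE (p⁻¹V) (pT⁻¹b⁻¹V) _`, module `G_V := (p⁻¹V).ι^* G` — commutes (`restrictBase_sq`) and is cartesian when the
  original square is (`isPullback_restrictBase`, Mathlib `Scheme.Hom.isPullback_resLE`);
* §2 **`forall_bijective_of_restrictBase`** — THE TRANSPORT (the base `V` may be moved along any `e : V ⟶ B`, e.g.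
  `V ≅ Spec Γ(S, V)`, so that affine-base theorems stated over `Spec A` apply verbatim; `p_B = p_V ≫ e`, `b_B = b_V ≫ e`): if
  the restricted square satisfies the `∃ e′` chart clause of ★ `isIso_pushforwardBaseChangeHom_of_charts_top` at an open
  `W′ ⊆ b⁻¹V` (`Γ(b⁻¹V, W′) ⊗_{Γ(B, ⊤)} Γ(p_{B*} G_V, ⊤) ≃ Γ(pT_{V*}(pr_V^* G_V), W′)` with the pure-tensor formula), then EVERY
  `Γ(T, W)`-linear map `F : Γ(T, W) ⊗_{Γ(S, V)} Γ(p_*G, V) → Γ(pT_*(pr^*G), W)` with the pure-tensor formula is bijective, where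
  `W = (b⁻¹V).ι ''ᵁ W′` — i.e. the «∀ F» chart clause of ★ `pushforwardBaseChangeHom_app_bijective_of_forall_bijective` for the
  ORIGINAL square at `(V, W)`.  Road (B-p19 (g15) 06:18Z): `F ∘ θ = ν ∘ e` with `θ (t ⊗ s′) = t ⊗ μ s′` SURJECTIVE
  (`μ : Γ(G_V, ⊤) ≅ Γ(G, p⁻¹V)`) and `ν : Γ(pr_V^* G_V, pT_V⁻¹W′) ≅ Γ(pr^*G, pT⁻¹W)` the pseudofunctoriality transport, both
  from ★ `Modules/PullbackSectionsTransport` — no cross-ring tensor congruence is needed;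
* §3 corollaries: `pushforwardBaseChangeHom_app_bijective_of_restrictBase` (one chart), and
  **`isIso_pushforwardBaseChangeHom_of_restrictBase`**: for `p_*G` affine-localizing, if for every affine `V ⊆ S` the square
  restricted over `V` satisfies the `∃ e` chart clause at every affine `W′ ⊆ b⁻¹V`, then `β` is an ISOMORPHISM.

Theorems only; no `sorry`, no instance, no named fact.  Cell hodgecm-mathlib, F-DAG (h2)/(h6-d), step (S3) of the split with
B-p19 (g15) (G9 = the affine-base chart theorem).  HC_CM is proved only modulo the printed citations until rung 0 closes; this
file discharges none of them.

## References
* [Hartshorne1977] R. Hartshorne, *Algebraic Geometry* (1977), III Prop. 9.3 (proof), II §5 p. 110.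
* [StacksProject] The Stacks Project, Tag 02KH (flat base change), Tag 02KG (affine base change), Tag 02N6 (base change map).
-/

noncomputable section

-- `TopCat.Presheaf`/`Scheme.Modules` are not reducible (as in Mathlib's `AlgebraicGeometry/Modules/Sheaf.lean`).
set_option backward.isDefEq.respectTransparency false

open CategoryTheory CategoryTheory.Limits AlgebraicGeometry TopologicalSpace Opposite TensorProduct

universe u

namespace Literature.AlgebraicGeometry.Modules

open Literature.AlgebraicGeometry.Motives

/-! ### §1 The square restricted over an open `V ⊆ S` -/

section Square

variable {X S T XT : Scheme.{u}} {pr : XT ⟶ X} {pT : XT ⟶ T} {p : X ⟶ S} {b : T ⟶ S} (w : pr ≫ p = pT ≫ b)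
  (V : S.Opens)

/-- The square restricted over `V ⊆ S` commutes: `pr_V ≫ p_V = pT_V ≫ b_V` (all four maps in Mathlib `resLE` letters).
[cite: Hartshorne1977, III Prop. 9.3 (proof)] -/
theorem restrictBase_sq :
    pr.resLE (p ⁻¹ᵁ V) (pT ⁻¹ᵁ (b ⁻¹ᵁ V)) (preimage_preimage_eq_of_sq w V).ge ≫ p.resLE V (p ⁻¹ᵁ V) le_rfl =
      pT.resLE (b ⁻¹ᵁ V) (pT ⁻¹ᵁ (b ⁻¹ᵁ V)) le_rfl ≫ b.resLE V (b ⁻¹ᵁ V) le_rfl := by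
  rw [← cancel_mono V.ι]
  simp only [Category.assoc, Scheme.Hom.resLE_comp_ι, Scheme.Hom.resLE_comp_ι_assoc, w]

/-- The square restricted over `V ⊆ S` is cartesian when the original square is (Mathlib `Scheme.Hom.isPullback_resLE`).
[cite: StacksProject, Tag 02KH] -/
theorem isPullback_restrictBase (H : IsPullback pr pT p b) :
    IsPullback (pr.resLE (p ⁻¹ᵁ V) (pT ⁻¹ᵁ (b ⁻¹ᵁ V)) (preimage_preimage_eq_of_sq H.w V).ge)
      (pT.resLE (b ⁻¹ᵁ V) (pT ⁻¹ᵁ (b ⁻¹ᵁ V)) le_rfl) (p.resLE V (p ⁻¹ᵁ V) le_rfl) (b.resLE V (b ⁻¹ᵁ V) le_rfl) :=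
  Scheme.Hom.isPullback_resLE H le_rfl le_rfl (by rw [preimage_preimage_eq_of_sq H.w V, inf_idem])

/-- The square restricted over `V ⊆ S`, with the base `V` replaced along any `e : V ⟶ B` (e.g. `V ≅ Spec Γ(S, V)` for `V`
affine), still commutes. [cite: Hartshorne1977, III Prop. 9.3 (proof)] -/
theorem restrictBase_sq_comp {B : Scheme.{u}} (e : V.toScheme ⟶ B) :
    pr.resLE (p ⁻¹ᵁ V) (pT ⁻¹ᵁ (b ⁻¹ᵁ V)) (preimage_preimage_eq_of_sq w V).ge ≫ (p.resLE V (p ⁻¹ᵁ V) le_rfl ≫ e) =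
      pT.resLE (b ⁻¹ᵁ V) (pT ⁻¹ᵁ (b ⁻¹ᵁ V)) le_rfl ≫ (b.resLE V (b ⁻¹ᵁ V) le_rfl ≫ e) := by
  rw [← Category.assoc, restrictBase_sq w V, Category.assoc]

end Square

/-! ### §2 THE TRANSPORT: the chart clause passes from the restricted square to the original square -/

section Transport

/-- Pure bookkeeping: `F ∘ θ = ν ∘ e` with `θ` surjective and `e`, `ν` bijective forces `F` bijective. [folklore] -/
private theorem bijective_of_comp_eq_comp {α β γ δ : Type*} {θ : α → β} {F : β → δ} {e : α → γ} {ν : γ → δ}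
    (hθ : Function.Surjective θ) (he : Function.Bijective e) (hν : Function.Bijective ν)
    (h : ∀ x, F (θ x) = ν (e x)) : Function.Bijective F := by
  refine ⟨fun x y hxy => ?_, fun z => ?_⟩
  · obtain ⟨x', rfl⟩ := hθ x
    obtain ⟨y', rfl⟩ := hθ y
    rw [h, h] at hxy
    rw [he.1 (hν.1 hxy)]
  · obtain ⟨y, hy⟩ := hν.2 z
    obtain ⟨x, hx⟩ := he.2 y
    exact ⟨θ x, by rw [h, hx, hy]⟩

variable {X S T XT : Scheme.{u}} {pr : XT ⟶ X} {pT : XT ⟶ T} {p : X ⟶ S} {b : T ⟶ S} (w : pr ≫ p = pT ≫ b)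
  (G : X.Modules) (V : S.Opens) {B : Scheme.{u}} (e : V.toScheme ⟶ B) (W' : (b ⁻¹ᵁ V).toScheme.Opens)

/-- **`ν` for the square restricted over `V`**, read on pushforward sections: an additive bijection
`Γ(pT_{V*}(pr_V^* G_V), W′) ≅ Γ(pT_*(pr^* G), W)` (`W = (b⁻¹V).ι ''ᵁ W′`) with
`ν (t · η_{pr_V}(η_{ιX}(m)|)|) = t · η_{pr}(m)|` (★ `exists_pullback_pullback_transport` with `k = pr_V`, plus the ring identity
`map_eqToHom_resLE_self_app_apply` for `pT_V♯ t = pT♯ t`). [cite: Hartshorne1977, III Prop. 9.3 (proof)] -/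
theorem exists_restrictBase_transport
    (i₀ : (p.resLE V (p ⁻¹ᵁ V) le_rfl ≫ e) ⁻¹ᵁ ⊤ ≤ (p ⁻¹ᵁ V).ι ⁻¹ᵁ (p ⁻¹ᵁ V))
    (j₁ : (pT.resLE (b ⁻¹ᵁ V) (pT ⁻¹ᵁ (b ⁻¹ᵁ V)) le_rfl) ⁻¹ᵁ W' ≤
      (pr.resLE (p ⁻¹ᵁ V) (pT ⁻¹ᵁ (b ⁻¹ᵁ V)) (preimage_preimage_eq_of_sq w V).ge) ⁻¹ᵁ
        ((p.resLE V (p ⁻¹ᵁ V) le_rfl ≫ e) ⁻¹ᵁ ⊤))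
    (j₂ : pT ⁻¹ᵁ ((b ⁻¹ᵁ V).ι ''ᵁ W') ≤ pr ⁻¹ᵁ (p ⁻¹ᵁ V)) :
    ∃ ν' : Γ((Scheme.Modules.pushforward (pT.resLE (b ⁻¹ᵁ V) (pT ⁻¹ᵁ (b ⁻¹ᵁ V)) le_rfl)).obj
          ((Scheme.Modules.pullback (pr.resLE (p ⁻¹ᵁ V) (pT ⁻¹ᵁ (b ⁻¹ᵁ V)) (preimage_preimage_eq_of_sq w V).ge)).obj
            ((Scheme.Modules.pullback (p ⁻¹ᵁ V).ι).obj G)), W') →+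
        Γ((Scheme.Modules.pushforward pT).obj ((Scheme.Modules.pullback pr).obj G), (b ⁻¹ᵁ V).ι ''ᵁ W'),
      Function.Bijective ν' ∧
      ∀ (t : Γ((b ⁻¹ᵁ V).toScheme, W')) (m : Γ(G, p ⁻¹ᵁ V)),
        ν' (t • (show Γ((Scheme.Modules.pushforward (pT.resLE (b ⁻¹ᵁ V) (pT ⁻¹ᵁ (b ⁻¹ᵁ V)) le_rfl)).obj
                ((Scheme.Modules.pullback
                  (pr.resLE (p ⁻¹ᵁ V) (pT ⁻¹ᵁ (b ⁻¹ᵁ V)) (preimage_preimage_eq_of_sq w V).ge)).obj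
                  ((Scheme.Modules.pullback (p ⁻¹ᵁ V).ι).obj G)), W') from
              unitSectionLE (pr.resLE (p ⁻¹ᵁ V) (pT ⁻¹ᵁ (b ⁻¹ᵁ V)) (preimage_preimage_eq_of_sq w V).ge)
                ((Scheme.Modules.pullback (p ⁻¹ᵁ V).ι).obj G) j₁ (unitSectionLE (p ⁻¹ᵁ V).ι G i₀ m))) =
          (show Γ(T, (b ⁻¹ᵁ V).ι ''ᵁ W') from t) •
            (show Γ((Scheme.Modules.pushforward pT).obj ((Scheme.Modules.pullback pr).obj G), (b ⁻¹ᵁ V).ι ''ᵁ W') from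
              unitSectionLE pr G j₂ m) := by
  obtain ⟨ν, hνb, hνc, hνη⟩ := exists_pullback_pullback_transport (p ⁻¹ᵁ V).ι (pT ⁻¹ᵁ (b ⁻¹ᵁ V)).ι
    (pr.resLE (p ⁻¹ᵁ V) (pT ⁻¹ᵁ (b ⁻¹ᵁ V)) (preimage_preimage_eq_of_sq w V).ge) pr (Scheme.Hom.resLE_comp_ι pr _) G
    i₀ j₁ (image_preimage_resLE_self pT (b ⁻¹ᵁ V) W').symm j₂
  have key : ∀ (t : Γ((b ⁻¹ᵁ V).toScheme, W')) (m : Γ(G, p ⁻¹ᵁ V)),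
      ν (((pT.resLE (b ⁻¹ᵁ V) (pT ⁻¹ᵁ (b ⁻¹ᵁ V)) le_rfl).app W' t) •
          unitSectionLE (pr.resLE (p ⁻¹ᵁ V) (pT ⁻¹ᵁ (b ⁻¹ᵁ V)) (preimage_preimage_eq_of_sq w V).ge)
            ((Scheme.Modules.pullback (p ⁻¹ᵁ V).ι).obj G) j₁ (unitSectionLE (p ⁻¹ᵁ V).ι G i₀ m)) =
        (pT.app ((b ⁻¹ᵁ V).ι ''ᵁ W') (show Γ(T, (b ⁻¹ᵁ V).ι ''ᵁ W') from t)) • unitSectionLE pr G j₂ m := by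
    intro t m
    rw [hνc, map_eqToHom_resLE_self_app_apply pT (b ⁻¹ᵁ V) W' t, hνη]
  exact ⟨ν, hνb, key⟩

/-- **`θ` for the square restricted over `V`**: the additive SURJECTION
`Γ(b⁻¹V, W′) ⊗_{Γ(B, ⊤)} Γ(p_{B*} G_V, ⊤) → Γ(T, W) ⊗_{Γ(S, V)} Γ(p_*G, V)`, `t ⊗ s′ ↦ t ⊗ μ s′`, for `μ` the transport of ★
`exists_sections_pullback_ι_transport` (balanced by the ring identities `resLE_self_appLE_top_apply` /
`resLE_self_app_top_apply`: `b_B♯ a = b♯(e♯ a)` and `p_B♯ a = p♯(e♯ a)`; surjective because `μ` is).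
[cite: Hartshorne1977, III Prop. 9.3 (proof)] -/
theorem exists_restrictBase_theta
    (i₀ : (p.resLE V (p ⁻¹ᵁ V) le_rfl ≫ e) ⁻¹ᵁ ⊤ ≤ (p ⁻¹ᵁ V).ι ⁻¹ᵁ (p ⁻¹ᵁ V))
    (hc : p ⁻¹ᵁ V = (p ⁻¹ᵁ V).ι ''ᵁ ((p.resLE V (p ⁻¹ᵁ V) le_rfl ≫ e) ⁻¹ᵁ ⊤))
    (μ : Γ((Scheme.Modules.pullback (p ⁻¹ᵁ V).ι).obj G, (p.resLE V (p ⁻¹ᵁ V) le_rfl ≫ e) ⁻¹ᵁ ⊤) →+ Γ(G, p ⁻¹ᵁ V))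
    (hμη : ∀ m : Γ(G, p ⁻¹ᵁ V), μ (unitSectionLE (p ⁻¹ᵁ V).ι G i₀ m) = m)
    (hμc : ∀ (c : Γ((p ⁻¹ᵁ V).toScheme, (p.resLE V (p ⁻¹ᵁ V) le_rfl ≫ e) ⁻¹ᵁ ⊤))
      (y : Γ((Scheme.Modules.pullback (p ⁻¹ᵁ V).ι).obj G, (p.resLE V (p ⁻¹ᵁ V) le_rfl ≫ e) ⁻¹ᵁ ⊤)),
      μ (c • y) = X.presheaf.map (eqToHom hc).op c • μ y) :
    letI := ((b.resLE V (b ⁻¹ᵁ V) le_rfl ≫ e).appLE ⊤ W' le_top).hom.toAlgebra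
    letI := (b.appLE V ((b ⁻¹ᵁ V).ι ''ᵁ W') ((b ⁻¹ᵁ V).ι_image_le W')).hom.toAlgebra
    ∃ θ : Γ((b ⁻¹ᵁ V).toScheme, W') ⊗[Γ(B, ⊤)]
          Γ((Scheme.Modules.pushforward (p.resLE V (p ⁻¹ᵁ V) le_rfl ≫ e)).obj
            ((Scheme.Modules.pullback (p ⁻¹ᵁ V).ι).obj G), ⊤) →+
        Γ(T, (b ⁻¹ᵁ V).ι ''ᵁ W') ⊗[Γ(S, V)] Γ((Scheme.Modules.pushforward p).obj G, V),
      Function.Surjective θ ∧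
      ∀ (t : Γ((b ⁻¹ᵁ V).toScheme, W'))
        (s' : Γ((Scheme.Modules.pushforward (p.resLE V (p ⁻¹ᵁ V) le_rfl ≫ e)).obj
          ((Scheme.Modules.pullback (p ⁻¹ᵁ V).ι).obj G), ⊤)),
        θ (t ⊗ₜ s') = (show Γ(T, (b ⁻¹ᵁ V).ι ''ᵁ W') from t) ⊗ₜ[Γ(S, V)]
          (show Γ((Scheme.Modules.pushforward p).obj G, V) from μ s') := by
  letI algW' : Algebra Γ(B, ⊤) Γ((b ⁻¹ᵁ V).toScheme, W') :=
    ((b.resLE V (b ⁻¹ᵁ V) le_rfl ≫ e).appLE ⊤ W' le_top).hom.toAlgebra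
  letI algW : Algebra Γ(S, V) Γ(T, (b ⁻¹ᵁ V).ι ''ᵁ W') :=
    (b.appLE V ((b ⁻¹ᵁ V).ι ''ᵁ W') ((b ⁻¹ᵁ V).ι_image_le W')).hom.toAlgebra
  -- the two ring identities: `p_B♯ a = p♯ (v a)` on `p⁻¹V` and `b_B♯ a = b♯ (v a)` on `W`, `v a = e♯ a` moved to `Γ(S, V)`
  have R1 : ∀ a : Γ(B, ⊤), X.presheaf.map (eqToHom hc).op ((p.resLE V (p ⁻¹ᵁ V) le_rfl ≫ e).app ⊤ a) =
      p.app V (V.topIso.hom (e.app ⊤ a)) := by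
    intro a
    have R0 : (p.resLE V (p ⁻¹ᵁ V) le_rfl ≫ e).app ⊤ a = (p.resLE V (p ⁻¹ᵁ V) le_rfl).app ⊤ (e.app ⊤ a) := by
      rw [Scheme.Hom.comp_app]
      rfl
    rw [R0, resLE_self_app_top_apply]
    exact map_eqToHom_topIso_inv (p ⁻¹ᵁ V) _
  have R2 : ∀ a : Γ(B, ⊤), (b.resLE V (b ⁻¹ᵁ V) le_rfl ≫ e).appLE ⊤ W' le_top a =
      b.appLE V ((b ⁻¹ᵁ V).ι ''ᵁ W') ((b ⁻¹ᵁ V).ι_image_le W') (V.topIso.hom (e.app ⊤ a)) := by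
    intro a
    have R0 : (b.resLE V (b ⁻¹ᵁ V) le_rfl ≫ e).appLE ⊤ W' le_top a =
        (b.resLE V (b ⁻¹ᵁ V) le_rfl).appLE ⊤ W' le_top (e.app ⊤ a) := by
      simp only [Scheme.Hom.appLE, Scheme.Hom.comp_app, CommRingCat.comp_apply, Category.assoc]
      rfl
    rw [R0, resLE_self_appLE_top_apply]
  -- the balanced biadditive map `(t, s′) ↦ t ⊗ μ s′`
  let f : Γ((b ⁻¹ᵁ V).toScheme, W') →+
      Γ((Scheme.Modules.pushforward (p.resLE V (p ⁻¹ᵁ V) le_rfl ≫ e)).obj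
        ((Scheme.Modules.pullback (p ⁻¹ᵁ V).ι).obj G), ⊤) →+
      Γ(T, (b ⁻¹ᵁ V).ι ''ᵁ W') ⊗[Γ(S, V)] Γ((Scheme.Modules.pushforward p).obj G, V) :=
    { toFun := fun t => (TensorProduct.mk Γ(S, V) Γ(T, (b ⁻¹ᵁ V).ι ''ᵁ W') Γ((Scheme.Modules.pushforward p).obj G, V)
          (show Γ(T, (b ⁻¹ᵁ V).ι ''ᵁ W') from t)).toAddMonoidHom.comp
          (show Γ((Scheme.Modules.pushforward (p.resLE V (p ⁻¹ᵁ V) le_rfl ≫ e)).obj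
            ((Scheme.Modules.pullback (p ⁻¹ᵁ V).ι).obj G), ⊤) →+ Γ((Scheme.Modules.pushforward p).obj G, V) from μ)
      map_zero' := by
        ext s'
        simp only [AddMonoidHom.comp_apply, LinearMap.toAddMonoidHom_coe, AddMonoidHom.zero_apply]
        exact TensorProduct.zero_tmul _ _
      map_add' := fun t₁ t₂ => by
        ext s'
        simp only [AddMonoidHom.comp_apply, LinearMap.toAddMonoidHom_coe, AddMonoidHom.add_apply]
        exact TensorProduct.add_tmul _ _ _ }
  have hf : ∀ t s', f t s' = (show Γ(T, (b ⁻¹ᵁ V).ι ''ᵁ W') from t) ⊗ₜ[Γ(S, V)]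
      (show Γ((Scheme.Modules.pushforward p).obj G, V) from μ s') := fun t s' => rfl
  have hbal : ∀ (a : Γ(B, ⊤)) (t : Γ((b ⁻¹ᵁ V).toScheme, W'))
      (s' : Γ((Scheme.Modules.pushforward (p.resLE V (p ⁻¹ᵁ V) le_rfl ≫ e)).obj
        ((Scheme.Modules.pullback (p ⁻¹ᵁ V).ι).obj G), ⊤)), f (a • t) s' = f t (a • s') := by
    intro a t s'
    rw [hf, hf]
    -- `a • s′ = p_B♯(a) • s′`, moved by `μ`
    have hs' : (show Γ((Scheme.Modules.pushforward p).obj G, V) from μ (a • s')) =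
        V.topIso.hom (e.app ⊤ a) • (show Γ((Scheme.Modules.pushforward p).obj G, V) from μ s') := by
      change μ (((p.resLE V (p ⁻¹ᵁ V) le_rfl ≫ e).app ⊤ a) • (show Γ((Scheme.Modules.pullback (p ⁻¹ᵁ V).ι).obj G,
        (p.resLE V (p ⁻¹ᵁ V) le_rfl ≫ e) ⁻¹ᵁ ⊤) from s')) =
        p.app V (V.topIso.hom (e.app ⊤ a)) • (show Γ(G, p ⁻¹ᵁ V) from μ s')
      rw [hμc, R1]
    -- `a • t = b_B♯(a) t = b♯(v a) t = (v a) • t`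
    have ht : (show Γ(T, (b ⁻¹ᵁ V).ι ''ᵁ W') from (a • t : Γ((b ⁻¹ᵁ V).toScheme, W'))) =
        (V.topIso.hom (e.app ⊤ a)) • (show Γ(T, (b ⁻¹ᵁ V).ι ''ᵁ W') from t) := by
      change (b.resLE V (b ⁻¹ᵁ V) le_rfl ≫ e).appLE ⊤ W' le_top a * t =
        b.appLE V ((b ⁻¹ᵁ V).ι ''ᵁ W') ((b ⁻¹ᵁ V).ι_image_le W') (V.topIso.hom (e.app ⊤ a)) *
          (show Γ(T, (b ⁻¹ᵁ V).ι ''ᵁ W') from t)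
      rw [R2]
    rw [hs', ht]
    exact TensorProduct.smul_tmul _ _ _
  refine ⟨TensorProduct.liftAddHom f hbal, fun z => ?_, fun t s' => by rw [TensorProduct.liftAddHom_tmul, hf]⟩
  -- surjectivity: pure tensors `t ⊗ s = θ (t ⊗ η(s))`
  induction z using TensorProduct.induction_on with
  | zero => exact ⟨0, (TensorProduct.liftAddHom f hbal).map_zero⟩
  | tmul t s =>
    refine ⟨t ⊗ₜ (show Γ((Scheme.Modules.pushforward (p.resLE V (p ⁻¹ᵁ V) le_rfl ≫ e)).obj
      ((Scheme.Modules.pullback (p ⁻¹ᵁ V).ι).obj G), ⊤) from unitSectionLE (p ⁻¹ᵁ V).ι G i₀ s), ?_⟩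
    rw [TensorProduct.liftAddHom_tmul, hf]
    change (show Γ(T, (b ⁻¹ᵁ V).ι ''ᵁ W') from t) ⊗ₜ[Γ(S, V)] (show Γ((Scheme.Modules.pushforward p).obj G, V) from
      μ (unitSectionLE (p ⁻¹ᵁ V).ι G i₀ s)) = _
    rw [hμη]
  | add x y hx hy =>
    obtain ⟨x', hx'⟩ := hx
    obtain ⟨y', hy'⟩ := hy
    exact ⟨x' + y', by rw [(TensorProduct.liftAddHom f hbal).map_add, hx', hy']⟩

/-- **The chart clause transports from the square restricted over `V` to the original square** ([Hartshorne1977] III 9.3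
(proof): «the question is local on the base»).  Let `pr ≫ p = pT ≫ b`, `G` an `𝒪_X`-module, `V ⊆ S` open, `e : V ⟶ B` any
morphism (typically `V ≅ Spec Γ(S, V)`), `W′ ⊆ b⁻¹V` open, and write `p_B = p_V ≫ e : p⁻¹V ⟶ B`, `b_B = b_V ≫ e`,
`G_V = (p⁻¹V).ι^* G`.  IF the restricted square `(pr_V, pT_V, p_B, b_B)` with the module `G_V` satisfies the `∃ e′` chart clause
of ★ `isIso_pushforwardBaseChangeHom_of_charts_top` at `W′` — an isomorphism
`Γ(b⁻¹V, W′) ⊗_{Γ(B, ⊤)} Γ(p_{B*} G_V, ⊤) ≃ Γ(pT_{V*}(pr_V^* G_V), W′)` with `t ⊗ s ↦ t · η_{pr_V}(s)|` — THEN every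
`Γ(T, W)`-linear `F : Γ(T, W) ⊗_{Γ(S, V)} Γ(p_*G, V) → Γ(pT_*(pr^*G), W)`, `W = (b⁻¹V).ι ''ᵁ W′`, with
`F (t ⊗ s) = t · η_{pr}(s)|_{pT⁻¹W}` is BIJECTIVE (the «∀ F» chart clause of ★
`pushforwardBaseChangeHom_app_bijective_of_forall_bijective` at `(V, W)`).  Proof: `F ∘ θ = ν ∘ e′` with `θ` the surjection
of ★ `exists_restrictBase_theta` and `ν` the bijection of ★ `exists_restrictBase_transport`.
[cite: Hartshorne1977, III Prop. 9.3 (proof)] [cite: StacksProject, Tag 02KH] -/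
theorem forall_bijective_of_restrictBase
    (h : letI := ((b.resLE V (b ⁻¹ᵁ V) le_rfl ≫ e).appLE ⊤ W' le_top).hom.toAlgebra
      ∃ e' : Γ((b ⁻¹ᵁ V).toScheme, W') ⊗[Γ(B, ⊤)]
            Γ((Scheme.Modules.pushforward (p.resLE V (p ⁻¹ᵁ V) le_rfl ≫ e)).obj
              ((Scheme.Modules.pullback (p ⁻¹ᵁ V).ι).obj G), ⊤) ≃ₗ[Γ((b ⁻¹ᵁ V).toScheme, W')]
          Γ((Scheme.Modules.pushforward (pT.resLE (b ⁻¹ᵁ V) (pT ⁻¹ᵁ (b ⁻¹ᵁ V)) le_rfl)).obj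
            ((Scheme.Modules.pullback (pr.resLE (p ⁻¹ᵁ V) (pT ⁻¹ᵁ (b ⁻¹ᵁ V)) (preimage_preimage_eq_of_sq w V).ge)).obj
              ((Scheme.Modules.pullback (p ⁻¹ᵁ V).ι).obj G)), W'),
        ∀ (t : Γ((b ⁻¹ᵁ V).toScheme, W'))
          (s : Γ((Scheme.Modules.pullback (p ⁻¹ᵁ V).ι).obj G, (p.resLE V (p ⁻¹ᵁ V) le_rfl ≫ e) ⁻¹ᵁ ⊤)),
          e' (t ⊗ₜ (show Γ((Scheme.Modules.pushforward (p.resLE V (p ⁻¹ᵁ V) le_rfl ≫ e)).obj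
              ((Scheme.Modules.pullback (p ⁻¹ᵁ V).ι).obj G), ⊤) from s)) =
            t • (show Γ((Scheme.Modules.pushforward (pT.resLE (b ⁻¹ᵁ V) (pT ⁻¹ᵁ (b ⁻¹ᵁ V)) le_rfl)).obj
                ((Scheme.Modules.pullback
                  (pr.resLE (p ⁻¹ᵁ V) (pT ⁻¹ᵁ (b ⁻¹ᵁ V)) (preimage_preimage_eq_of_sq w V).ge)).obj
                  ((Scheme.Modules.pullback (p ⁻¹ᵁ V).ι).obj G)), W') from
              unitSectionLE (pr.resLE (p ⁻¹ᵁ V) (pT ⁻¹ᵁ (b ⁻¹ᵁ V)) (preimage_preimage_eq_of_sq w V).ge)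
                ((Scheme.Modules.pullback (p ⁻¹ᵁ V).ι).obj G)
                ((Scheme.Hom.preimage_mono (pT.resLE (b ⁻¹ᵁ V) (pT ⁻¹ᵁ (b ⁻¹ᵁ V)) le_rfl)
                  (le_top : W' ≤ (b.resLE V (b ⁻¹ᵁ V) le_rfl ≫ e) ⁻¹ᵁ ⊤)).trans
                  (preimage_preimage_eq_of_sq (restrictBase_sq_comp w V e) ⊤).ge) s)) :
    letI := (b.appLE V ((b ⁻¹ᵁ V).ι ''ᵁ W') ((b ⁻¹ᵁ V).ι_image_le W')).hom.toAlgebra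
    ∀ F : Γ(T, (b ⁻¹ᵁ V).ι ''ᵁ W') ⊗[Γ(S, V)] Γ((Scheme.Modules.pushforward p).obj G, V) →ₗ[Γ(T, (b ⁻¹ᵁ V).ι ''ᵁ W')]
        Γ((Scheme.Modules.pushforward pT).obj ((Scheme.Modules.pullback pr).obj G), (b ⁻¹ᵁ V).ι ''ᵁ W'),
      (∀ (t : Γ(T, (b ⁻¹ᵁ V).ι ''ᵁ W')) (s : Γ(G, p ⁻¹ᵁ V)),
          F (t ⊗ₜ (show Γ((Scheme.Modules.pushforward p).obj G, V) from s)) =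
            t • (show Γ((Scheme.Modules.pushforward pT).obj ((Scheme.Modules.pullback pr).obj G), (b ⁻¹ᵁ V).ι ''ᵁ W') from
              unitSectionLE pr G ((Scheme.Hom.preimage_mono pT ((b ⁻¹ᵁ V).ι_image_le W')).trans
                (preimage_preimage_eq_of_sq w V).ge) s)) →
      Function.Bijective F := by
  intro F hF
  obtain ⟨e', he'⟩ := h
  -- the opens and inequalities of the restricted square
  have i₀ : (p.resLE V (p ⁻¹ᵁ V) le_rfl ≫ e) ⁻¹ᵁ ⊤ ≤ (p ⁻¹ᵁ V).ι ⁻¹ᵁ (p ⁻¹ᵁ V) :=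
    le_top.trans (Scheme.Opens.ι_preimage_self _).ge
  have hc : p ⁻¹ᵁ V = (p ⁻¹ᵁ V).ι ''ᵁ ((p.resLE V (p ⁻¹ᵁ V) le_rfl ≫ e) ⁻¹ᵁ ⊤) := by
    rw [TopologicalSpace.Opens.map_top]
    exact (Scheme.Opens.ι_image_top _).symm
  have j₁ : (pT.resLE (b ⁻¹ᵁ V) (pT ⁻¹ᵁ (b ⁻¹ᵁ V)) le_rfl) ⁻¹ᵁ W' ≤
      (pr.resLE (p ⁻¹ᵁ V) (pT ⁻¹ᵁ (b ⁻¹ᵁ V)) (preimage_preimage_eq_of_sq w V).ge) ⁻¹ᵁ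
        ((p.resLE V (p ⁻¹ᵁ V) le_rfl ≫ e) ⁻¹ᵁ ⊤) :=
    (Scheme.Hom.preimage_mono (pT.resLE (b ⁻¹ᵁ V) (pT ⁻¹ᵁ (b ⁻¹ᵁ V)) le_rfl)
      (le_top : W' ≤ (b.resLE V (b ⁻¹ᵁ V) le_rfl ≫ e) ⁻¹ᵁ ⊤)).trans
      (preimage_preimage_eq_of_sq (restrictBase_sq_comp w V e) ⊤).ge
  have j₂ : pT ⁻¹ᵁ ((b ⁻¹ᵁ V).ι ''ᵁ W') ≤ pr ⁻¹ᵁ (p ⁻¹ᵁ V) :=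
    (Scheme.Hom.preimage_mono pT ((b ⁻¹ᵁ V).ι_image_le W')).trans (preimage_preimage_eq_of_sq w V).ge
  -- μ, ν, θ
  obtain ⟨μ, hμη, hημ, hμc⟩ := exists_sections_pullback_ι_transport G (p ⁻¹ᵁ V)
    ((p.resLE V (p ⁻¹ᵁ V) le_rfl ≫ e) ⁻¹ᵁ ⊤) (TopologicalSpace.Opens.map_top _) i₀ hc
  obtain ⟨ν', hν'b, hν'⟩ := exists_restrictBase_transport w G V e W' i₀ j₁ j₂
  obtain ⟨θ, hθs, hθ⟩ := exists_restrictBase_theta G V e W' i₀ hc μ hμη hμc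
  -- `F ∘ θ = ν ∘ e′` on pure tensors, hence everywhere
  refine bijective_of_comp_eq_comp hθs e'.bijective hν'b fun x => ?_
  induction x using TensorProduct.induction_on with
  | zero => rw [θ.map_zero, F.map_zero, e'.map_zero, ν'.map_zero]
  | add x y hx hy => rw [θ.map_add, F.map_add, e'.map_add, ν'.map_add, hx, hy]
  | tmul t s' =>
    have hνs := hν' t (μ s')
    rw [hημ s'] at hνs
    exact ((congrArg F (hθ t s')).trans (hF _ (μ s'))).trans (hνs.symm.trans (congrArg ν' (he' t s')).symm)

end Transport

/-! ### §3 Corollaries: one chart, and `IsIso` from the restricted squares over an affine cover -/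

section Corollaries

variable {X S T XT : Scheme.{u}} {pr : XT ⟶ X} {pT : XT ⟶ T} {p : X ⟶ S} {b : T ⟶ S} (w : pr ≫ p = pT ≫ b)
  (G : X.Modules)

/-- **One chart**: for `p_*G` affine-localizing, `V ⊆ S` affine, `e : V ⟶ B`, `W′ ⊆ b⁻¹V` affine, the `∃ e′` chart clause of the
square restricted over `V` (base moved along `e`) at `W′` makes `β_W` bijective for `W = (b⁻¹V).ι ''ᵁ W′`
(★ `forall_bijective_of_restrictBase` + ★ `pushforwardBaseChangeHom_app_bijective_of_forall_bijective`).
[cite: Hartshorne1977, III Prop. 9.3 (proof)] [cite: StacksProject, Tag 02KH] -/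
theorem pushforwardBaseChangeHom_app_bijective_of_restrictBase
    (hN : IsAffineLocalizing ((Scheme.Modules.pushforward p).obj G)) {V : S.Opens} (hV : IsAffineOpen V)
    {B : Scheme.{u}} (e : V.toScheme ⟶ B) (W' : (b ⁻¹ᵁ V).toScheme.Opens) (hW' : IsAffineOpen W')
    (h : letI := ((b.resLE V (b ⁻¹ᵁ V) le_rfl ≫ e).appLE ⊤ W' le_top).hom.toAlgebra
      ∃ e' : Γ((b ⁻¹ᵁ V).toScheme, W') ⊗[Γ(B, ⊤)]
            Γ((Scheme.Modules.pushforward (p.resLE V (p ⁻¹ᵁ V) le_rfl ≫ e)).obj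
              ((Scheme.Modules.pullback (p ⁻¹ᵁ V).ι).obj G), ⊤) ≃ₗ[Γ((b ⁻¹ᵁ V).toScheme, W')]
          Γ((Scheme.Modules.pushforward (pT.resLE (b ⁻¹ᵁ V) (pT ⁻¹ᵁ (b ⁻¹ᵁ V)) le_rfl)).obj
            ((Scheme.Modules.pullback (pr.resLE (p ⁻¹ᵁ V) (pT ⁻¹ᵁ (b ⁻¹ᵁ V)) (preimage_preimage_eq_of_sq w V).ge)).obj
              ((Scheme.Modules.pullback (p ⁻¹ᵁ V).ι).obj G)), W'),
        ∀ (t : Γ((b ⁻¹ᵁ V).toScheme, W'))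
          (s : Γ((Scheme.Modules.pullback (p ⁻¹ᵁ V).ι).obj G, (p.resLE V (p ⁻¹ᵁ V) le_rfl ≫ e) ⁻¹ᵁ ⊤)),
          e' (t ⊗ₜ (show Γ((Scheme.Modules.pushforward (p.resLE V (p ⁻¹ᵁ V) le_rfl ≫ e)).obj
              ((Scheme.Modules.pullback (p ⁻¹ᵁ V).ι).obj G), ⊤) from s)) =
            t • (show Γ((Scheme.Modules.pushforward (pT.resLE (b ⁻¹ᵁ V) (pT ⁻¹ᵁ (b ⁻¹ᵁ V)) le_rfl)).obj
                ((Scheme.Modules.pullback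
                  (pr.resLE (p ⁻¹ᵁ V) (pT ⁻¹ᵁ (b ⁻¹ᵁ V)) (preimage_preimage_eq_of_sq w V).ge)).obj
                  ((Scheme.Modules.pullback (p ⁻¹ᵁ V).ι).obj G)), W') from
              unitSectionLE (pr.resLE (p ⁻¹ᵁ V) (pT ⁻¹ᵁ (b ⁻¹ᵁ V)) (preimage_preimage_eq_of_sq w V).ge)
                ((Scheme.Modules.pullback (p ⁻¹ᵁ V).ι).obj G)
                ((Scheme.Hom.preimage_mono (pT.resLE (b ⁻¹ᵁ V) (pT ⁻¹ᵁ (b ⁻¹ᵁ V)) le_rfl)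
                  (le_top : W' ≤ (b.resLE V (b ⁻¹ᵁ V) le_rfl ≫ e) ⁻¹ᵁ ⊤)).trans
                  (preimage_preimage_eq_of_sq (restrictBase_sq_comp w V e) ⊤).ge) s)) :
    Function.Bijective ((pushforwardBaseChangeHom w G).app ((b ⁻¹ᵁ V).ι ''ᵁ W')) :=
  pushforwardBaseChangeHom_app_bijective_of_forall_bijective w G hN hV (hW'.image_of_isOpenImmersion _)
    ((b ⁻¹ᵁ V).ι_image_le W') (forall_bijective_of_restrictBase w G V e W' h)

/-- **The base-change morphism is an isomorphism when the squares restricted over an affine cover of the base satisfy the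
affine-base chart clause** ([Hartshorne1977] III 9.3 (proof), [StacksProject, Tag 02KH]): for `p_*G` affine-localizing, bases
`e V : V ⟶ B V` for the affine opens `V ⊆ S` (e.g. `V ≅ Spec Γ(S, V)`), if for every affine `V` and every affine `W′ ⊆ b⁻¹V` the
square restricted over `V` satisfies the `∃ e′` chart clause of ★ `isIso_pushforwardBaseChangeHom_of_charts_top` at `W′`, then
`pushforwardBaseChangeHom w G` is an isomorphism (affine `W ⊆ b⁻¹V`, `V` affine, form a basis of `T`, ★
`isBasis_affineOpens_le_preimage`; each is `(b⁻¹V).ι ''ᵁ W′` with `W′` affine).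
[cite: Hartshorne1977, III Prop. 9.3 (proof)] [cite: StacksProject, Tag 02KH] -/
theorem isIso_pushforwardBaseChangeHom_of_restrictBase
    (hN : IsAffineLocalizing ((Scheme.Modules.pushforward p).obj G))
    {B : ∀ V : S.Opens, IsAffineOpen V → Scheme.{u}} (e : ∀ (V : S.Opens) (hV : IsAffineOpen V), V.toScheme ⟶ B V hV)
    (h : ∀ (V : S.Opens) (hV : IsAffineOpen V) (W' : (b ⁻¹ᵁ V).toScheme.Opens) (_ : IsAffineOpen W'),
      letI := ((b.resLE V (b ⁻¹ᵁ V) le_rfl ≫ e V hV).appLE ⊤ W' le_top).hom.toAlgebra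
      ∃ e' : Γ((b ⁻¹ᵁ V).toScheme, W') ⊗[Γ(B V hV, ⊤)]
            Γ((Scheme.Modules.pushforward (p.resLE V (p ⁻¹ᵁ V) le_rfl ≫ e V hV)).obj
              ((Scheme.Modules.pullback (p ⁻¹ᵁ V).ι).obj G), ⊤) ≃ₗ[Γ((b ⁻¹ᵁ V).toScheme, W')]
          Γ((Scheme.Modules.pushforward (pT.resLE (b ⁻¹ᵁ V) (pT ⁻¹ᵁ (b ⁻¹ᵁ V)) le_rfl)).obj
            ((Scheme.Modules.pullback (pr.resLE (p ⁻¹ᵁ V) (pT ⁻¹ᵁ (b ⁻¹ᵁ V)) (preimage_preimage_eq_of_sq w V).ge)).obj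
              ((Scheme.Modules.pullback (p ⁻¹ᵁ V).ι).obj G)), W'),
        ∀ (t : Γ((b ⁻¹ᵁ V).toScheme, W'))
          (s : Γ((Scheme.Modules.pullback (p ⁻¹ᵁ V).ι).obj G, (p.resLE V (p ⁻¹ᵁ V) le_rfl ≫ e V hV) ⁻¹ᵁ ⊤)),
          e' (t ⊗ₜ (show Γ((Scheme.Modules.pushforward (p.resLE V (p ⁻¹ᵁ V) le_rfl ≫ e V hV)).obj
              ((Scheme.Modules.pullback (p ⁻¹ᵁ V).ι).obj G), ⊤) from s)) =
            t • (show Γ((Scheme.Modules.pushforward (pT.resLE (b ⁻¹ᵁ V) (pT ⁻¹ᵁ (b ⁻¹ᵁ V)) le_rfl)).obj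
                ((Scheme.Modules.pullback
                  (pr.resLE (p ⁻¹ᵁ V) (pT ⁻¹ᵁ (b ⁻¹ᵁ V)) (preimage_preimage_eq_of_sq w V).ge)).obj
                  ((Scheme.Modules.pullback (p ⁻¹ᵁ V).ι).obj G)), W') from
              unitSectionLE (pr.resLE (p ⁻¹ᵁ V) (pT ⁻¹ᵁ (b ⁻¹ᵁ V)) (preimage_preimage_eq_of_sq w V).ge)
                ((Scheme.Modules.pullback (p ⁻¹ᵁ V).ι).obj G)
                ((Scheme.Hom.preimage_mono (pT.resLE (b ⁻¹ᵁ V) (pT ⁻¹ᵁ (b ⁻¹ᵁ V)) le_rfl)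
                  (le_top : W' ≤ (b.resLE V (b ⁻¹ᵁ V) le_rfl ≫ e V hV) ⁻¹ᵁ ⊤)).trans
                  (preimage_preimage_eq_of_sq (restrictBase_sq_comp w V (e V hV)) ⊤).ge) s)) :
    IsIso (pushforwardBaseChangeHom w G) := by
  refine isIso_of_bijective_on_basis _ (isBasis_affineOpens_le_preimage b) fun W hW => ?_
  obtain ⟨hWa, V, hV, i⟩ := hW
  have hW'a : IsAffineOpen ((b ⁻¹ᵁ V).ι ⁻¹ᵁ W) :=
    hWa.preimage_of_isOpenImmersion (b ⁻¹ᵁ V).ι (by rw [Scheme.Opens.opensRange_ι]; exact i)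
  have hWeq : (b ⁻¹ᵁ V).ι ''ᵁ ((b ⁻¹ᵁ V).ι ⁻¹ᵁ W) = W := by
    rw [Scheme.Hom.image_preimage_eq_opensRange_inf, Scheme.Opens.opensRange_ι]
    exact inf_eq_right.mpr i
  have hB := pushforwardBaseChangeHom_app_bijective_of_restrictBase w G hN hV (e V hV) _ hW'a (h V hV _ hW'a)
  rw [hWeq] at hB
  exact hB

end Corollaries

end Literature.AlgebraicGeometry.Modules

end
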